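import Mathlib
import Summits.AtomisticToContinuum.Crystallization.Theorems.FrustratedLawDichotomyPeriodicChargeSplitGSCDoor
import Summits.AtomisticToContinuum.Crystallization.Theses.FrustratedLawDichotomy
import Summits.AtomisticToContinuum.Crystallization.Theses.PeriodicChargeSplit

/-!
# FrustratedLawDichotomy · crux `PeriodicFrustratedLawGap` (stmt-AtomisticToContinuum-27624, sibling of `AperiodicFrustratedLawGap`) —
# THE DOOR-FREE SURGERY-CURRENCY REDUCTION: Φper ⟸ PeriodicMinimiserCharge (stmt-26655, Palm bookkeeping) ∧ «no textured Nash periodic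
# translate is an e⋆-μGSC» (decomp-a2c, prover hand 2, structural share, generation 5)

Generation-5 door `FrustratedLawDichotomyGSCDoorNormalised.periodicFrustratedLawGap_of_muEquilibriumDoor_per` needed the μ-equilibrium door of
item 27073 (tree-proved, farm-unbuilt).  For the PERIODIC sibling that door is now superfluous: an exact periodic minimiser is an `e⋆`-μGSC
unconditionally (`FrustratedLawDichotomyPeriodicMuGSC.isMuGSC_points_of_energyPerParticle_le`).  Hence
`periodicFrustratedLawGap_of_charge_of_noTexturedPeriodicGSC`:
`PeriodicChargeSplit.PeriodicMinimiserCharge → R_GSC^perQ → FrustratedLawDichotomy.PeriodicFrustratedLawGap` (all BY NAME / verbatim), where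
`PeriodicMinimiserCharge` (stmt-26655) is lens-2's TRUE-type Palm bookkeeping «a law charging periodic translates with mean `≤ e⋆` charges one
textured Nash periodic translate `Q + t` with `e(Q) ≤ e⋆`» and `R_GSC^perQ` is the law-free residual «no `δ`-separated textured Nash translate
`Q.points + t` of a periodic configuration is an `e⋆`-μGSC of `V_LJ`» (binders of `PeriodicChargeSplit.NoFrustratedPeriodicMinimiser`,
conclusion replaced; cf. `FrustratedLawDichotomyPeriodicChargeSplitGSCDoor`).  `[folklore]` bookkeeping.
-/

noncomputable section

namespace Summit.AtomisticToContinuum.Crystallization.Theorems.FrustratedLawDichotomyPeriodicGapChargeDoor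

open Literature.MathematicalPhysics.StatisticalMechanics
open Summit.AtomisticToContinuum.Crystallization.Theorems.FrustratedLawDichotomyPeriodicMuGSC (isMuGSC_points_of_energyPerParticle_le)
open Summit.AtomisticToContinuum.Crystallization.Theorems.FrustratedLawDichotomyPeriodicChargeSplitGSCDoor (exists_translate)

/-- **Φper, DOOR-FREE, IN SURGERY CURRENCY**: `PeriodicMinimiserCharge → R_GSC^perQ → PeriodicFrustratedLawGap`.  If `∫ rootEnergy ∂P ≤ e⋆`,
the charge gives a textured Nash `δ`-separated translate `Q + t` with `e(Q) ≤ e⋆`; the translate is an exact periodic minimiser, hence an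
`e⋆`-μGSC (unconditionally), which `R_GSC^perQ` forbids. [folklore] -/
theorem periodicFrustratedLawGap_of_charge_of_noTexturedPeriodicGSC
    (hC : Summit.AtomisticToContinuum.Crystallization.Theses.PeriodicChargeSplit.PeriodicMinimiserCharge)
    (hR : ∀ δ : ℝ, 0 < δ → ∀ (Q : Literature.MathematicalPhysics.StatisticalMechanics.PeriodicConfiguration 3) (t : EuclideanSpace ℝ (Fin 3)), let Gy : ℝ → (N : ℕ) → (Fin N → EuclideanSpace ℝ (Fin 3)) → Fin N → Prop := fun η N y j => let d : ℝ := sInf ((fun z => dist z (y (j : Fin N))) '' (Set.range (y) \ {(y (j : Fin N))})); let T : Set (EuclideanSpace ℝ (Fin 3)) := {z : EuclideanSpace ℝ (Fin 3) | z ∈ Set.range (y) ∧ z ≠ (y (j : Fin N)) ∧ dist z (y (j : Fin N)) < 13 / 10 * d}; ∃ A : EuclideanSpace ℝ (Fin 3) →ₗᵢ[ℝ] EuclideanSpace ℝ (Fin 3), (∃ e : ↥T ≃ ↥Literature.Geometry.DiscreteGeometry.fccKissingPattern, ∀ t : ↥T, dist (d⁻¹ • ((t : EuclideanSpace ℝ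 (Fin 3)) - (y (j : Fin N)))) (A ((e t : ↥Literature.Geometry.DiscreteGeometry.fccKissingPattern) : EuclideanSpace ℝ (Fin 3))) ≤ η) ∨ (∃ e : ↥T ≃ ↥Literature.Geometry.DiscreteGeometry.hcpKissingPattern, ∀ t : ↥T, dist (d⁻¹ • ((t : EuclideanSpace ℝ (Fin 3)) - (y (j : Fin N)))) (A ((e t : ↥Literature.Geometry.DiscreteGeometry.hcpKissingPattern) : EuclideanSpace ℝ (Fin 3))) ≤ η); let TexBall : (N : ℕ) → (Fin N → EuclideanSpace ℝ (Fin 3)) → Fin N → ℝ → ℝ → ℝ → ℝ → Prop := fun N y i R R₇ R₈ R₉ => (∀ a b : Fin N, a ≠ b → (7 : ℝ) / 10 ≤ dist (y a) (y b)) ∧ (∀ j : Fin N, dist (y j) (y i) ≤ R → ¬ Gy (1 / 20) N (y) j) ∧ (∀ j : Fin N, dist (y j) (y i) ≤ R → ¬ ((∀ j' : Fin N, dist (y j') (y j) ≤ R₇ → ¬ Gy (1 / 20) N (y) j') ∧ (∀ z : EuclideanSpace ℝ (Fin 3), dist z (y j) ≤ R₇ → ∃ k : Fin N, dist z (y k)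 ≤ 1) ∧ (∀ j' : Fin N, dist (y j') (y j) ≤ R₇ → (let d : ℝ := sInf ((fun z => dist z (y j')) '' (Set.range (y) \ {(y j')})); ∀ k : Fin N, y k ≠ y j' → dist (y k) (y j') < 27 / 20 * d → 5 ≤ Nat.card {m : Fin N // y m ≠ y j' ∧ dist (y m) (y j') < 27 / 20 * d ∧ y m ≠ y k ∧ dist (y m) (y k) < 27 / 20 * d})))) ∧ (∀ j : Fin N, dist (y j) (y i) ≤ R → ∃ k : Fin N, dist (y k) (y j) ≤ R₈ ∧ Gy (1 / 8) N (y) k) ∧ (∀ j : Fin N, dist (y j) (y i) ≤ R → ¬ ((∀ j' : Fin N, dist (y j') (y j) ≤ R₉ → ¬ Gy (1 / 20) N (y) j') ∧ (Nat.card {j' : Fin N // dist (y j') (y j) ≤ R₉ ∧ ¬ Gy (1 / 8) N (y) j'} : ℝ) ≤ 1 / 2 * (Nat.card {j' : Fin N // dist (y j') (y j) ≤ R₉} : ℝ) ∧ (∀ j' : Fin N, dist (y j') (y j) ≤ R₉ → ¬ Gy (1 / 8) N (y) j' → ¬ (let d : ℝ := sInf ((fun z => dist z (y j')) '' (Set.range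 (y) \ {(y j')})); ∀ k : Fin N, y k ≠ y j' → dist (y k) (y j') < 27 / 20 * d → 5 ≤ Nat.card {m : Fin N // y m ≠ y j' ∧ dist (y m) (y j') < 27 / 20 * d ∧ y m ≠ y k ∧ dist (y m) (y k) < 27 / 20 * d})))); let ApprS : Set (EuclideanSpace ℝ (Fin 3)) → ℝ → ℝ → ℝ → Prop := fun S R₇ R₈ R₉ => ∀ q : EuclideanSpace ℝ (Fin 3), q ∈ S → ∀ R ε : ℝ, 0 < ε → ∃ (N : ℕ) (y : Fin N → EuclideanSpace ℝ (Fin 3)) (i : Fin N), TexBall N y i R R₇ R₈ R₉ ∧ (∀ p : EuclideanSpace ℝ (Fin 3), p ∈ S → dist p q ≤ R → ∃ k : Fin N, dist (y k - y i) (p - q) ≤ ε) ∧ (∀ k : Fin N, dist (y k) (y i) ≤ R → ∃ p : EuclideanSpace ℝ (Fin 3), p ∈ S ∧ dist (y k - y i) (p - q) ≤ ε); let NashS : Set (EuclideanSpace ℝ (Fin 3)) → Prop := fun S => ∀ p : EuclideanSpace ℝ (Fin 3), p ∈ S → ∀ y : EuclideanSpace ℝ (Fin 3), (∀ q : EuclideanSpace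 ℝ (Fin 3), q ∈ S → q ≠ p → y ≠ q) → ∑' q : {q : EuclideanSpace ℝ (Fin 3) // q ∈ S ∧ q ≠ p}, Literature.MathematicalPhysics.StatisticalMechanics.lennardJones (dist p (q : EuclideanSpace ℝ (Fin 3))) ≤ ∑' q : {q : EuclideanSpace ℝ (Fin 3) // q ∈ S ∧ q ≠ p}, Literature.MathematicalPhysics.StatisticalMechanics.lennardJones (dist y (q : EuclideanSpace ℝ (Fin 3))); (∀ p ∈ ((fun s => s + t) '' Q.points), ∀ q ∈ ((fun s => s + t) '' Q.points), p ≠ q → δ ≤ dist p q) → (∃ R₇ R₈ R₉ : ℝ, ApprS ((fun s => s + t) '' Q.points) R₇ R₈ R₉) → NashS ((fun s => s + t) '' Q.points) → ¬ Literature.MathematicalPhysics.StatisticalMechanics.IsMuGSC Literature.MathematicalPhysics.StatisticalMechanics.lennardJones (⨅ Q : Literature.MathematicalPhysics.StatisticalMechanics.PeriodicConfiguration 3, Q.energyPerParticle Literature.MathematicalPhysics.StatisticalMechanics.lennardJones) ((fun s => s + t) '' Q.points)) :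
    Summit.AtomisticToContinuum.Crystallization.Theses.FrustratedLawDichotomy.PeriodicFrustratedLawGap := by
  intro δ hδ P
  have hC' := hC δ hδ P
  have hR' := hR δ hδ
  dsimp only at hC' hR' ⊢
  intro hP hcore hstat happr hnash hper
  by_contra hlt
  rw [not_lt] at hlt
  obtain ⟨Q, t, hsep, happrS, hnashS, hle⟩ := hC' hP hcore hstat happr hnash hper hlt
  obtain ⟨Q', hpts, hen⟩ := exists_translate Q t
  have hsep' : ∀ p ∈ Q'.points, ∀ q ∈ Q'.points, p ≠ q → δ ≤ dist p q := by rw [hpts]; exact hsep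
  have hopt : Q'.energyPerParticle lennardJones ≤ ⨅ Q'' : PeriodicConfiguration 3, Q''.energyPerParticle lennardJones := by
    rw [hen]; exact hle
  have hG := isMuGSC_points_of_energyPerParticle_le Q' hδ hsep' hopt
  rw [hpts] at hG
  exact hR' Q t hsep happrS hnashS hG

end Summit.AtomisticToContinuum.Crystallization.Theorems.FrustratedLawDichotomyPeriodicGapChargeDoor

end
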